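import Summits.Ventures.LatticeQCDFlow.Scoring.BesselToeplitzLaplace
import Summits.Ventures.LatticeQCDFlow.Scoring.TorusFreeEnergyAnalytic2D
import HarnessLib

/-!
# The weak-coupling asymptotics of the free energy density of two-dimensional `U(N)` lattice Yang–Mills for EVERY `N`: `f_N(β) + (N²/2) log β → K_N = log M_N − N log 2π − log N!`

HONEST FRAMING: exact (Metropolis-corrected) sampling algorithms for lattice gauge theory;
figures of merit are autocorrelation/cost numbers at stated couplings and volumes; no
continuum-physics claim.

Venture `LatticeQCDFlow` (cell pub-lqcd), sub-topic `Scoring`; FANOUT row 5 (`s0-sun-a`), GEN-20.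
NEW WORK of the cell (placement rule).  GEN-19 (27) `TorusFreeEnergyAnalytic2D`: the free energy density of
two-dimensional `U(N)` lattice Yang–Mills in the Literature's S17 vocabulary is
`freeEnergyDensity 2 ρ_{U(N)} β = −Nβ + log det[I_{|i−j|}(β)]_{N×N}` at every real `β`.  GEN-20
`BesselToeplitzLaplace`: `det[I_{|i−j|}(β)] e^{−Nβ} √β^{N²} → M_N/((2π)^N N!)` with Mehta's integral
`M_N = ∫_{ℝ^N} e^{−|φ|²/2} Π_{j≺k}(φ_j − φ_k)² dφ > 0`.  Hence, for EVERY `N`: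

* **`tendsto_unitary_freeEnergyDensity_two_add_log`** — `f_N(β) + (N²/2) log β → log (M_N / ((2π)^N N!))` as `β → ∞`:
  THE FREE ENERGY OF 2-d `U(N)` LATTICE YANG–MILLS IS `−(N²/2) log β + K_N + o(1)` AT WEAK COUPLING, the coefficient
  `N²/2 = dim U(N)/2` counting the Gaussian modes per plaquette;
* **`unitary_freeEnergyDensity_two_leadingTerm`** — the S17-SHAPED statement in `d = 2` for every `N`:
  `(∀ β, HasFreeEnergyDensity 2 ρ_{U(N)} β (freeEnergyDensity 2 ρ_{U(N)} β)) ∧ ∃ c K, f_N(β) − c log β → K` with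
  `c = −N²/2` (the Literature's named fact `chatterjee_freeEnergyDensity` is the four-dimensional statement of this
  shape, `c = −(d−1)N²/2`; here `d − 1 = 1`, a THEOREM).

NOT CLAIMED: the closed form `K_N = log Π_{j=1}^{N−1} j! − (N/2) log 2π` (needs Mehta's evaluation of `M_N`,
`-- TODO(general form)`; for `N = 1` it is GEN-20 (29)'s `−½ log 2π`); `SU(N)` for `N ≥ 3`; `d ≥ 3`.
No `def`, nothing cited as a fact, 0 sorry.
-/

noncomputable section

open Real MeasureTheory Filter Topology
open Literature.MathematicalPhysics.QuantumLattice (unitaryFundamentalRep HasFreeEnergyDensity freeEnergyDensity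
  hasFreeEnergyDensity_freeEnergyDensity)
open Literature.Analysis.FunctionSpaces (besselI)
open Literature.RepresentationTheory.CompactGroups.WeylIntegration (OD)

namespace Summit.Ventures.LatticeQCDFlow.Scoring

/-- **WEAK-COUPLING ASYMPTOTICS OF THE 2-d `U(N)` FREE ENERGY, EVERY `N`**: as `β → ∞`,
`freeEnergyDensity 2 ρ_{U(N)} β + (N²/2) log β → log (M_N / ((2π)^N N!))`,
`M_N = ∫_{ℝ^N} e^{−Σφ_b²/2} Π_{j≺k}(φ_j − φ_k)² dφ`. -/
theorem tendsto_unitary_freeEnergyDensity_two_add_log (N : ℕ) :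
    Tendsto (fun β : ℝ => freeEnergyDensity 2 (unitaryFundamentalRep (Fin N) ℂ) β + (N : ℝ) ^ 2 / 2 * Real.log β)
      atTop (𝓝 (Real.log ((∫ φ : Fin N → ℝ, Real.exp (∑ b, -(φ b ^ 2 / 2)) *
        ∏ p : OD (Fin N), (φ p.1.1 - φ p.1.2) ^ 2) / ((2 * π) ^ N * N.factorial)))) := by
  have hM := gaussVandermonde_pos (n := Fin N)
  have hK : (0 : ℝ) < (2 * π) ^ N * N.factorial := by positivity
  have h := (tendsto_det_besselI_toeplitz_weakCoupling N).log (div_pos hM hK).ne'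
  refine h.congr' ?_
  filter_upwards [eventually_gt_atTop (0 : ℝ)] with β hβ
  have hD := det_besselI_toeplitz_fin_pos N β
  have hs : 0 < √β := Real.sqrt_pos.2 hβ
  rw [Real.log_mul (mul_pos hD (Real.exp_pos _)).ne' (pow_pos hs _).ne', Real.log_mul hD.ne' (Real.exp_pos _).ne',
    Real.log_exp, Real.log_pow, Real.log_sqrt hβ.le, freeEnergyDensity_two_unitary_eq]
  push_cast
  ring

/-- **THE LEADING TERM OF THE 2-d `U(N)` FREE ENERGY, S17-SHAPED, EVERY `N`**: (i) the free energy density exists at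
every `β`; (ii) `∃ c K, f_N(β) − c log β → K` as `β → ∞`, with `c = −N²/2` and
`K = log (M_N/((2π)^N N!))`. -/
theorem unitary_freeEnergyDensity_two_leadingTerm (N : ℕ) :
    (∀ β : ℝ, HasFreeEnergyDensity 2 (unitaryFundamentalRep (Fin N) ℂ) β
        (freeEnergyDensity 2 (unitaryFundamentalRep (Fin N) ℂ) β)) ∧
      ∃ c K : ℝ, Tendsto
        (fun β : ℝ => freeEnergyDensity 2 (unitaryFundamentalRep (Fin N) ℂ) β - c * Real.log β) atTop (𝓝 K) := by
  refine ⟨fun β => hasFreeEnergyDensity_freeEnergyDensity _ ⟨_, hasFreeEnergyDensity_two_unitary N β⟩,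
    -((N : ℝ) ^ 2 / 2), _, (tendsto_unitary_freeEnergyDensity_two_add_log N).congr' (Eventually.of_forall fun β => ?_)⟩
  ring

-- TODO(general form): `K_N = log Π_{j=1}^{N−1} j! − (N/2) log 2π` via Mehta's integral `M_N = (2π)^{N/2} Π_{j=1}^{N} j!`.

end Summit.Ventures.LatticeQCDFlow.Scoring
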